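import Summits.NavierStokesRegularity.FunctionalMining.NoGo.MiddleEigenvalueKillAllWitness
import Mathlib.Analysis.Calculus.BumpFunction.InnerProduct
import Mathlib.Analysis.Calculus.LocalExtr.Basic
import Mathlib.MeasureTheory.Integral.IntegralEqImproper
import Mathlib.MeasureTheory.Measure.Haar.NormedSpace
import HarnessLib

/-!
# K1-Q2 kill-all witness, part 5/6: one-dimensional facts for the sixth moment (`q = 6`)

Search for candidate a priori estimates; no regularity claim. NS FUNCTIONAL MINING — NO-GO BRANCH
(cell `pub-nsfunc`, no-go seat gen 7).
Vertical factors: `∫₀¹ Vⁱ Vz'ʲ = 0` for odd `j` (reflection `t ↦ 1 - t`), `∫₀¹ Vz Vz'⁴ = 6π⁴`,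
`∫₀¹ V³ Vz'² = 7π²/2` (explicit trigonometric antiderivatives). Horizontal factors: the scaling law
`Ib a b e = 2ᵉ/2ᵃ⁺¹ · Ia a b e`, `∫ fⁿ f' = 0` for compactly supported `C¹` functions (`Ia 0 3 1 = 0`),
the reflection symmetry of the Mathlib bump about its centre (`A (1/4 - u) = A (1/4 + u)`, hence
`∫ A A'³ = 0`, `Ia 0 1 3 = 0`), and nonnegativity of moments with an even power of `A'`.
Nothing is asserted about Navier–Stokes regularity.
-/

noncomputable section

open MeasureTheory Set Function Filter Topology Metric
open scoped ContDiff Real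

namespace Summit.NavierStokesRegularity.FunctionalMining

namespace KillAll

open Literature.Analysis Literature.Analysis.FluidPDE Literature.Analysis.FunctionSpaces
  Literature.Analysis.FunctionSpaces.Torus

/-! ## Sixth moment (`q = 6`): additional one-dimensional facts

For `m = 3` the integrand `|ω|⁴ σ` expands into 46 separable rows with vertical factors
`Vz^i Vz'^j`, `(i,j) ∈ {(1,1),(1,3),(1,2),(3,1),(1,4),(1,5),(3,2),(3,3),(5,1)}`; odd `j` integrate to `0`
(symmetry `t ↦ 1 - t`), and `∫₀¹ Vz Vz'⁴ = 6π⁴`, `∫₀¹ V³ Vz'² = 7π²/2`. The horizontal factors reduce, by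
translation, the scaling `∫ (t-½)ᵃ A(2(t-½))ᵇ (2A'(2(t-½)))ᵉ = 2ᵉ/2ᵃ⁺¹ ∫ tᵃ A(t)ᵇ A'(t)ᵉ`, exactness
`∫ A³A' = 0` and the reflection symmetry of the bump (`∫ A A'³ = 0`), to sign-definite moments. -/

/-- Auxiliary declaration `Vz_one_sub` of the q = 6 profile integrals (file 5/6) (NOGO N11 kill-all chain; search for candidate a priori estimates; no regularity claim). -/
theorem Vz_one_sub (t : ℝ) : Vz (1 - t) = Vz t := by
  unfold Vz
  rw [show 2 * π * (1 - t) = 2 * π - 2 * π * t by ring, Real.cos_two_pi_sub]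

/-- Auxiliary declaration `dVz_one_sub` of the q = 6 profile integrals (file 5/6) (NOGO N11 kill-all chain; search for candidate a priori estimates; no regularity claim). -/
theorem dVz_one_sub (t : ℝ) : dVz (1 - t) = -dVz t := by
  unfold dVz
  rw [show 2 * π * (1 - t) = 2 * π - 2 * π * t by ring, Real.sin_two_pi_sub]
  ring

/-- `∫₀¹ Vⁱ Vz'ʲ = 0` for odd `j` (the integrand is odd under `t ↦ 1 - t`). [folklore] -/
theorem integral_VdV_odd (i j : ℕ) (hj : Odd j) : ∫ t in (0 : ℝ)..1, Vz t ^ i * dVz t ^ j = 0 := by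
  have h := intervalIntegral.integral_comp_sub_left (fun t => Vz t ^ i * dVz t ^ j) (1 : ℝ)
    (a := 0) (b := 1)
  have hf : ∀ t, Vz (1 - t) ^ i * dVz (1 - t) ^ j = -(Vz t ^ i * dVz t ^ j) := fun t => by
    rw [Vz_one_sub, dVz_one_sub, hj.neg_pow]; ring
  simp only [hf, intervalIntegral.integral_neg, sub_self, sub_zero] at h
  linarith

/-- `∫₀¹ Vz Vz'⁴ = 6π⁴` (explicit trigonometric antiderivative). [folklore] -/
theorem integral_V_dV4 : ∫ t in (0 : ℝ)..1, Vz t * dVz t ^ 4 = 6 * π ^ 4 := by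
  set Ψ : ℝ → ℝ := fun t => 16 * π ^ 3 * (3 / 8 * π * t
    - Real.sin (2 * π * t) * Real.cos (2 * π * t) / 4
    + Real.sin (2 * π * t) * Real.cos (2 * π * t) * (2 * Real.cos (2 * π * t) ^ 2 - 1) / 16
    - Real.sin (2 * π * t) ^ 5 / 10) with hΨ
  have h : ∀ t ∈ uIcc (0 : ℝ) 1, HasDerivAt Ψ (Vz t * dVz t ^ 4) t := fun t _ => by
    have hc := hasDerivAt_cos_two_pi_mul t
    have hs := hasDerivAt_sin_two_pi_mul t
    have ht : HasDerivAt (fun t : ℝ => 3 / 8 * π * t) (3 / 8 * π) t := by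
      simpa using (hasDerivAt_id t).const_mul (3 / 8 * π)
    have hA := hs.mul hc
    have hB := (hs.mul hc).mul (((hc.fun_pow 2).const_mul 2).sub_const 1)
    have := (((ht.sub (hA.div_const 4)).add (hB.div_const 16)).sub
      ((hs.fun_pow 5).div_const 10)).const_mul (16 * π ^ 3)
    refine this.congr_deriv ?_
    simp only [Vz, dVz, Pi.mul_apply]
    push_cast
    linear_combination ((-6 : ℝ) * π ^ 4 + 4 * Real.cos (2 * π * t) ^ 2 * π ^ 4
      - 16 * Real.sin (2 * π * t) ^ 2 * π ^ 4) * Real.sin_sq_add_cos_sq (2 * π * t)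
  rw [intervalIntegral.integral_eq_sub_of_hasDerivAt h
    ((continuous_Vz.mul (continuous_dVz.pow 4)).intervalIntegrable 0 1)]
  simp [hΨ]
  ring

/-- `∫₀¹ V³ Vz'² = 7π²/2` (explicit trigonometric antiderivative). [folklore] -/
theorem integral_V3_dV2 : ∫ t in (0 : ℝ)..1, Vz t ^ 3 * dVz t ^ 2 = 7 / 2 * π ^ 2 := by
  set Ψ : ℝ → ℝ := fun t => 2 * π * (7 / 4 * π * t
    - Real.sin (2 * π * t) * Real.cos (2 * π * t) / 2
    - 3 * (Real.sin (2 * π * t) * Real.cos (2 * π * t) * (2 * Real.cos (2 * π * t) ^ 2 - 1)) / 8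
    - 4 * Real.sin (2 * π * t) ^ 3 / 3
    + Real.sin (2 * π * t) ^ 5 / 5) with hΨ
  have h : ∀ t ∈ uIcc (0 : ℝ) 1, HasDerivAt Ψ (Vz t ^ 3 * dVz t ^ 2) t := fun t _ => by
    have hc := hasDerivAt_cos_two_pi_mul t
    have hs := hasDerivAt_sin_two_pi_mul t
    have ht : HasDerivAt (fun t : ℝ => 7 / 4 * π * t) (7 / 4 * π) t := by
      simpa using (hasDerivAt_id t).const_mul (7 / 4 * π)
    have hA := hs.mul hc
    have hB := (hs.mul hc).mul (((hc.fun_pow 2).const_mul 2).sub_const 1)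
    have := ((((ht.sub (hA.div_const 2)).sub ((hB.const_mul 3).div_const 8)).sub
      (((hs.fun_pow 3).const_mul 4).div_const 3)).add ((hs.fun_pow 5).div_const 5)).const_mul (2 * π)
    refine this.congr_deriv ?_
    simp only [Vz, dVz, Pi.mul_apply]
    push_cast
    linear_combination ((-7 / 2 : ℝ) * π ^ 2 - 3 * Real.cos (2 * π * t) ^ 2 * π ^ 2
      + 4 * Real.sin (2 * π * t) ^ 2 * Real.cos (2 * π * t) * π ^ 2) * Real.sin_sq_add_cos_sq (2 * π * t)
  rw [intervalIntegral.integral_eq_sub_of_hasDerivAt h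
    (((continuous_Vz.pow 3).mul (continuous_dVz.pow 2)).intervalIntegrable 0 1)]
  simp [hΨ]
  ring

/-- `∫ fⁿ f' = 0` for a `C¹` function with compact support. [folklore] -/
theorem integral_pow_mul_deriv_eq_zero {f : ℝ → ℝ} (hf : ContDiff ℝ 1 f) (hs : HasCompactSupport f)
    (n : ℕ) : ∫ t, f t ^ n * deriv f t = 0 := by
  have hd : ∀ t, HasDerivAt (fun t => f t ^ (n + 1) / (n + 1)) (f t ^ n * deriv f t) t := fun t => by
    have := ((hf.differentiable one_ne_zero t).hasDerivAt.fun_pow (n + 1)).div_const ((n : ℝ) + 1)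
    refine this.congr_deriv ?_
    have hn : ((n : ℝ) + 1) ≠ 0 := by positivity
    field_simp
    push_cast
    ring
  have hc : Continuous f := hf.continuous
  have hc' : Continuous (deriv f) := hf.continuous_deriv le_rfl
  refine integral_eq_zero_of_hasDerivAt_of_integrable hd ?_ ?_
  · exact ((hc.pow n).mul hc').integrable_of_hasCompactSupport hs.deriv.mul_left
  · exact ((hc.pow (n + 1)).div_const _).integrable_of_hasCompactSupport (by
      refine HasCompactSupport.intro (K := tsupport f) hs fun t ht => ?_
      simp [image_eq_zero_of_notMem_tsupport ht])

/-- The scaling law `Ib a b e = 2ᵉ/2ᵃ⁺¹ · Ia a b e`. -/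
theorem Ib_eq (a b e : ℕ) : Ib a b e = 2 ^ e / 2 ^ (a + 1) * Ia a b e := by
  unfold Ia Ib
  rw [show (fun t => sh t ^ a * A (2 * sh t) ^ b * (2 * deriv A (2 * sh t)) ^ e) =
      fun t => (fun u => u ^ a * A (2 * u) ^ b * (2 * deriv A (2 * u)) ^ e) (t - 1 / 2) from rfl,
    integral_sub_right_eq_self (fun u => u ^ a * A (2 * u) ^ b * (2 * deriv A (2 * u)) ^ e)
      (1 / 2 : ℝ),
    show (fun t => sh t ^ a * A (sh t) ^ b * deriv A (sh t) ^ e) =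
      fun t => (fun u => u ^ a * A u ^ b * deriv A u ^ e) (t - 1 / 2) from rfl,
    integral_sub_right_eq_self (fun u => u ^ a * A u ^ b * deriv A u ^ e) (1 / 2 : ℝ)]
  have h1 : (fun u : ℝ => u ^ a * A (2 * u) ^ b * (2 * deriv A (2 * u)) ^ e) =
      fun u => (fun w => (w / 2) ^ a * A w ^ b * (2 * deriv A w) ^ e) (2 * u) := by
    funext u
    simp only [mul_div_cancel_left₀ u (two_ne_zero (α := ℝ))]
  rw [h1, Measure.integral_comp_mul_left (fun w => (w / 2) ^ a * A w ^ b * (2 * deriv A w) ^ e) 2]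
  have h2 : (fun w : ℝ => (w / 2) ^ a * A w ^ b * (2 * deriv A w) ^ e) =
      fun w => (2 ^ e / 2 ^ a) * (w ^ a * A w ^ b * deriv A w ^ e) := by
    funext w
    rw [div_pow, mul_pow]
    ring
  rw [h2, integral_const_mul, abs_of_pos (by norm_num : (0 : ℝ) < 2⁻¹), smul_eq_mul, pow_succ]
  ring

/-- Auxiliary declaration `Ia_031` of the q = 6 profile integrals (file 5/6) (NOGO N11 kill-all chain; search for candidate a priori estimates; no regularity claim). -/
theorem Ia_031 : Ia 0 3 1 = 0 := by
  unfold Ia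
  simp only [pow_zero, pow_one, one_mul]
  rw [show (fun t => A (sh t) ^ 3 * deriv A (sh t)) =
      fun t => (fun u => A u ^ 3 * deriv A u) (t - 1 / 2) from rfl,
    integral_sub_right_eq_self (fun u => A u ^ 3 * deriv A u) (1 / 2 : ℝ)]
  exact integral_pow_mul_deriv_eq_zero (contDiff_A.of_le (by simp)) jetBump.hasCompactSupport 3

/-- Auxiliary declaration `Ib_031` of the q = 6 profile integrals (file 5/6) (NOGO N11 kill-all chain; search for candidate a priori estimates; no regularity claim). -/
theorem Ib_031 : Ib 0 3 1 = 0 := by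
  rw [Ib_eq, Ia_031, mul_zero]

/-- The jet bump is symmetric about its centre `1/4`. -/
theorem A_symm (u : ℝ) : A (1 / 4 - u) = A (1 / 4 + u) := by
  show jetBump.toFun (1 / 4 - u) = jetBump.toFun (1 / 4 + u)
  simp only [ContDiffBump.toFun, Function.comp]
  rw [show (1 / 4 - u - 1 / 4 : ℝ) = -(1 / 4 + u - 1 / 4) by ring, smul_neg,
    (someContDiffBumpBase ℝ).symmetric]

/-- Auxiliary declaration `A_half_sub` of the q = 6 profile integrals (file 5/6) (NOGO N11 kill-all chain; search for candidate a priori estimates; no regularity claim). -/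
theorem A_half_sub (t : ℝ) : A (1 / 2 - t) = A t := by
  have := A_symm (t - 1 / 4)
  rw [show (1 / 4 - (t - 1 / 4) : ℝ) = 1 / 2 - t by ring,
    show (1 / 4 + (t - 1 / 4) : ℝ) = t by ring] at this
  exact this

/-- Auxiliary declaration `dA_half_sub` of the q = 6 profile integrals (file 5/6) (NOGO N11 kill-all chain; search for candidate a priori estimates; no regularity claim). -/
theorem dA_half_sub (t : ℝ) : deriv A (1 / 2 - t) = -deriv A t := by
  have hfun : A = fun s => A (1 / 2 - s) := funext fun s => (A_half_sub s).symm
  conv_rhs => rw [hfun]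
  rw [deriv_comp_const_sub]
  ring

/-- `∫ A A'³ = 0`: the integrand is odd about the centre of the bump. -/
theorem Ia_013 : Ia 0 1 3 = 0 := by
  unfold Ia
  simp only [pow_zero, pow_one, one_mul]
  rw [show (fun t => A (sh t) * deriv A (sh t) ^ 3) =
      fun t => (fun u => A u * deriv A u ^ 3) (t - 1 / 2) from rfl,
    integral_sub_right_eq_self (fun u => A u * deriv A u ^ 3) (1 / 2 : ℝ)]
  have h := integral_sub_left_eq_self (fun u => A u * deriv A u ^ 3) (1 / 2 : ℝ) (μ := volume)
  simp only [A_half_sub, dA_half_sub] at h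
  have h' : ∫ u, A u * (-deriv A u) ^ 3 = -∫ u, A u * deriv A u ^ 3 := by
    rw [← integral_neg]; congr 1; funext u; ring
  linarith

/-- Auxiliary declaration `Ib_013` of the q = 6 profile integrals (file 5/6) (NOGO N11 kill-all chain; search for candidate a priori estimates; no regularity claim). -/
theorem Ib_013 : Ib 0 1 3 = 0 := by
  rw [Ib_eq, Ia_013, mul_zero]

/-- Moments with an even power of `A'` are nonnegative (the bump lives in `t > 0`). -/
theorem Ia_nonneg {a b e : ℕ} (hbe : b ≠ 0 ∨ e ≠ 0) (he : Even e) : 0 ≤ Ia a b e := by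
  unfold Ia
  refine integral_nonneg fun t => ?_
  by_cases h : sh t ≤ 1 / 8
  · have hA := A_eq_zero_of_nonpos h
    have hA' := dA_eq_zero_of_A_eq_zero hA
    rcases hbe with hb | hb
    · simp [hA, zero_pow hb]
    · simp [hA', zero_pow hb]
  · exact mul_nonneg (mul_nonneg (pow_nonneg (by linarith) _) (pow_nonneg (A_nonneg _) _))
      (he.pow_nonneg _)


end KillAll

end Summit.NavierStokesRegularity.FunctionalMining

end
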